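import Summits.BirchSwinnertonDyer.BirchSwinnertonDyer.Theorems.UniversalToricDescentAdditiveLocalTerm
import HarnessLib

/-!
# Route UniversalToricDescent — Greenberg–Vatsal Prop. (2.4) in CLOSED FORM at every place `v ∤ p`
# finitely decomposed in `K_∞`: `#H¹(kerD κ v, E[p^∞])[p] = p^{s_v}` with `s_v` read off the reduction type

Lead prover bsd-wall-utd-p1 g10 (`--supports stmt-BirchSwinnertonDyer-20399`; the VALUE of the local term
`s_v` of 21845's algebraic half `invariantsTransportT_algebraicHalf_lambda`, all reduction types in one
statement). Assembly of the three closed forms by the local trichotomy good / multiplicative / additive: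

* good `v` (g9, `UniversalToricDescentGoodLocalTermTrichotomy`): `s_v = 0` if `p ∤ q_v + 1 − a_v`,
  `s_v = 2` if `p ∣ q_v + 1 − a_v` and `p ∣ q_v − 1`, `s_v = 1` otherwise;
* split multiplicative `v` (g9, `UniversalToricDescentMultiplicativeLocalTerm`): `s_v = [p ∣ 1 − q_v]`;
  non-split multiplicative `v`: `s_v = [p ∣ −1 − q_v]`;
* additive `v` (g10, `UniversalToricDescentAdditiveLocalTerm`): `s_v = 0`.

In every case `s_v` is the multiplicity of `q_v⁻¹` as a root of the Euler factor `P̃_v(X) mod p`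
(Greenberg–Vatsal's `d_v`; `P_v = 1 − a_v X + q_v X²`, `1 − a_v X`, `1`), i.e. the `λ`-invariant of the
Euler factor `P_v(q_v⁻¹ γ_v)` removed in the `Σ`-imprimitive `p`-adic `L`-function: the algebraic and the
analytic `Σ`-corrections of Greenberg–Vatsal's Thm. (1.4) agree place by place.

* `natCard_pTorsion_subgroupH1_kerD_eq_pow_ite` — the closed form.

THEOREMS ONLY; no definition, no named fact, no `sorry`. BSD is not advanced by this file.
References: [GreenbergVatsal2000] §2 Prop. (2.4) and its proof (arXiv p. 22), (2.10); [GreenbergLNM1716]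
§3 Lemma 3.3; [SilvermanAEC2009] VII.5 Prop. 5.1 (local trichotomy).
-/

set_option autoImplicit false
-- `…BirchSwinnertonDyer.BirchSwinnertonDyer.Theorems…` is the problem's mandated namespace (D-0017).
set_option linter.dupNamespace false

noncomputable section

open scoped Classical

namespace Summit.BirchSwinnertonDyer.BirchSwinnertonDyer.Theorems.UniversalToricDescentLocalTermClosedForm

open Function NumberField IsDedekindDomain Field WeierstrassCurve
open Literature.NumberTheory.EllipticCurves Literature.NumberTheory.EllipticCurves.GreenbergSelmer
  IsDedekindDomain.HeightOneSpectrum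
  Summit.BirchSwinnertonDyer.Rank1Residual.X11b Summit.BirchSwinnertonDyer.Rank1Residual.X11b.Coinv
  Summit.BirchSwinnertonDyer.Rank1Residual.Iwasawa
  Summit.BirchSwinnertonDyer.BirchSwinnertonDyer.Theorems.UniversalToricDescentGoodLocalTermTrichotomy
  Summit.BirchSwinnertonDyer.BirchSwinnertonDyer.Theorems.UniversalToricDescentMultiplicativeLocalTerm
  Summit.BirchSwinnertonDyer.BirchSwinnertonDyer.Theorems.UniversalToricDescentAdditiveLocalTerm

variable {K : Type} [Field K] [NumberField K] (W : WeierstrassCurve K) [W.IsElliptic] {p : ℕ}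
  [Fact p.Prime] (κ : ZpExtension K p) {v : HeightOneSpectrum (𝓞 K)}

/-- **Greenberg–Vatsal Prop. (2.4), closed form at every place `v ∤ p` finitely decomposed in `K_∞`.**
With `q_v = #k_v` and `a_v = W.frobeniusTraceAt v`:
`#{f ∈ H¹(kerD κ v, E[p^∞]) : p • f = 0} = p^{s_v}`, where `s_v` is: at a GOOD place, `0` if
`p ∤ q_v + 1 − a_v`, else `2` if `p ∣ q_v − 1`, else `1`; at a SPLIT multiplicative place `[p ∣ 1 − q_v]`;
at a NON-SPLIT multiplicative place `[p ∣ −1 − q_v]`; at an ADDITIVE place `0`. In each case `s_v` is the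
multiplicity of the eigenvalue `q_v` of Frobenius on `(E[p]^{P_v})_{I_v}` — Greenberg–Vatsal's `d_v`.
[cite: GreenbergVatsal2000, §2 Prop. (2.4) and proof (arXiv p. 22)] [cite: GreenbergLNM1716, §3 Lemma 3.3]
[cite: SilvermanAEC2009, VII.5 Prop. 5.1] -/
theorem natCard_pTorsion_subgroupH1_kerD_eq_pow_ite (hpv : (p : 𝓞 K) ∉ v.asIdeal)
    (hD : ¬ (decomp v ≤ κ.kerSubgroup)) :
    Nat.card {f : Literature.NumberTheory.EllipticCurves.subgroupH1 (kerD κ v)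
        (W.geomPrimaryTorsion p) // p • f = 0} =
      p ^ (if W.HasGoodReductionAt v then
              (if (p : ℤ) ∣ (Nat.card (IsLocalRing.ResidueField (v.adicCompletionIntegers K)) : ℤ) + 1 -
                    W.frobeniusTraceAt v then
                (if (p : ℤ) ∣ (Nat.card (IsLocalRing.ResidueField (v.adicCompletionIntegers K)) : ℤ) - 1
                  then 2 else 1)
                else 0)
            else if W.HasSplitMultiplicativeReductionAt v then
              (if (p : ℤ) ∣ 1 - (Nat.card (IsLocalRing.ResidueField (v.adicCompletionIntegers K)) : ℤ)
                then 1 else 0)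
            else if W.HasMultiplicativeReductionAt v then
              (if (p : ℤ) ∣ -1 - (Nat.card (IsLocalRing.ResidueField (v.adicCompletionIntegers K)) : ℤ)
                then 1 else 0)
            else 0) := by
  rcases hasGoodReductionAt_or_hasMultiplicativeReductionAt_or_hasAdditiveReductionAt v W with
    hg | hm | ha
  · rw [if_pos hg]
    exact natCard_pTorsion_subgroupH1_kerD_eq_pow W κ hpv hD hg
  · rw [if_neg hm.not_hasGoodReductionAt]
    by_cases hs : W.HasSplitMultiplicativeReductionAt v
    · rw [if_pos hs]
      exact natCard_pTorsion_subgroupH1_kerD_eq_pow_of_hasMultiplicativeReductionAt W κ hpv hD hm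
        (Or.inl ⟨hs, rfl⟩)
    · rw [if_neg hs, if_pos hm]
      exact natCard_pTorsion_subgroupH1_kerD_eq_pow_of_hasMultiplicativeReductionAt W κ hpv hD hm
        (Or.inr ⟨hs, rfl⟩)
  · have hng : ¬ W.HasGoodReductionAt v := ha.not_hasGoodReductionAt
    have hnm : ¬ W.HasMultiplicativeReductionAt v := fun h ↦ h.not_hasAdditiveReductionAt ha
    have hns : ¬ W.HasSplitMultiplicativeReductionAt v := fun h ↦ hnm h.hasMultiplicativeReductionAt
    rw [if_neg hng, if_neg hns, if_neg hnm, pow_zero]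
    exact natCard_pTorsion_subgroupH1_kerD_eq_one_of_hasAdditiveReductionAt W κ hpv hD ha

end Summit.BirchSwinnertonDyer.BirchSwinnertonDyer.Theorems.UniversalToricDescentLocalTermClosedForm

end
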